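import Literature.Geometry.Kaehler.ComplexTorusProductFubini
import Literature.Geometry.Kaehler.ComplexTorusNakaiMoishezon
import Literature.Geometry.Kaehler.ComplexTorusPoincareFormula
import Literature.Geometry.Kaehler.ComplexTorusSemipositiveIntersection
import Literature.Geometry.Kaehler.ComplexTorusDivisorClassesIsogeny
import Literature.Geometry.Kaehler.ComplexTorusHodgeRiemann
import Literature.Geometry.Kaehler.ComplexTorusMixedLefschetzDecomposition
import HarnessLib

/-!
# Restriction of constant-coefficient forms to a complex hyperplane, `∫_X (Ω' ∧ π_ξ) ∧ B = κ · ∫_{X_H} Ω'|_H ∧ B|_H`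
# (`κ > 0`), and Timorin's hyperplane step: mixed Hodge–Riemann in dimension `g - 1` ⇒ mixed hard Lefschetz in
# dimension `g` (Timorin 1998; the `(1,1)` case is Aleksandrov's induction, Shenfeld–van Handel 2019 §4)

Layer `Literature/Geometry/Kaehler`, namespace `Literature.Geometry.Kaehler.ComplexTorus`; lane `lit-hodgefound`
(Track 2, HodgeConjecture), file T3 of the programme "mixed Hodge–Riemann bilinear relations in every bidegree on a
complex torus" (T1 = `LinearAlgebra/QuadraticForm/SignatureContinuousFamily`, T2 =
`ComplexTorusMixedLefschetzDecomposition`). Everything here is linear algebra of constant-coefficient forms on a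
finite-dimensional complex vector space `E` (the invariant forms of a complex torus `X = E/Λ`); no named facts.

## Mathematical content

Timorin proved the mixed Hodge–Riemann bilinear relations for `Λ^{p,q}(ℂⁿ)` "using Aleksandrov's approach"
(Dinh–Nguyên 2006, §1 before Thm. 1.3; their Prop. 2.1 restates the result). Aleksandrov's approach is an induction
on the dimension whose engine is the identity `D(e_i e_i^*, M_2, …, M_{n-1}) = c · D(M_2^{⟨i⟩}, …, M_{n-1}^{⟨i⟩})`
(Shenfeld–van Handel, Lemma 2.6 (f): a mixed discriminant with one rank-one argument is a mixed discriminant of the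
minors on the corresponding hyperplane), used in their §4, Lemma 4.2, to pass from the inequality in dimension `n - 1`
to dimension `n`. This file proves the form-level version of that identity in every bidegree and the resulting
induction step:

* §1 restriction along a complex-linear map preserves conjugation, the type `(p,q)` (tree
  `IsOfTypeAt.compContinuousLinearMap`), and positivity of real `(1,1)`-forms;
* §2 the complex orientation frame `(w_0, iw_0, w_1, iw_1, …)` of a concatenated family, and the block evaluation
  **`(π_ξ ∧ Ψ)(v, iv, u_1, iu_1, …) = |ξ(v)|² · Ψ|_S(u_1, iu_1, …)`** for `u` in a complex subspace `S ⊆ ker ξ`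
  (`π_ξ = (i/2) ξ ∧ ξ̄` is the tree's `principalTwoForm ξ`; the tree's Fubini-on-frames lemma
  `wedge_apply_append_of_forall_eq_zero` does the shuffle bookkeeping);
* §3 hence, for complex tori `X` on `E` (dimension `1 + m`) and `X_S` on a hyperplane `S ⊆ ker ξ` (dimension `m`),
  **`∫_X π_ξ ∧ Ψ = κ · ∫_{X_S} Ψ|_S` with one `κ > 0` for all `Ψ`** (`exists_pos_torusIntegral_principalTwoForm_wedge_eq_mul`);
* §4 a `k`-form with `k < dim E` vanishing on all the coordinate hyperplanes of a complex basis is zero;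
* §5–§7 the same for the mixed Hodge–Riemann integrand `(θ_1 ∧ ⋯ ∧ θ_r ∧ π_ξ) ∧ B`: the last background form moved
  to the front (`2`-forms are central, computed in the ring of graded forms `GForm`), restriction is a ring map, the
  frame identity `wedgeFamily_snoc_principalTwoForm_wedge_apply_interleave_append` and its `∫`-form
  `exists_pos_torusIntegral_wedgeFamily_snoc_principalTwoForm_wedge_eq_mul`;
* §8 `dim ker ξ = dim E - 1`, the coordinate functionals, a real-linear chart `ℝ^{2m} ≃ F`;
* §9 **the hyperplane step** `eq_zero_of_wedgeFamily_wedge_eq_zero_of_hyperplanes`: if `θ_n` is a positive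
  `(1,1)`-form and the mixed Hodge–Riemann inequality (in the frame form `σ · (Ω'|_S ∧ A' ∧ Ā')(u, iu, …) > 0` for
  non-zero primitive `A' ∈ Λ^{p,q}(S)`) holds on every complex subspace `S` of dimension `dim E - 1` for the
  restricted background, then `(Θ_0 ∧ ⋯ ∧ Θ_n) ∧ A = 0 ⇒ A = 0` on `Λ^{p,q}(E)` (`p + q < dim E`). Proof as in
  Aleksandrov/Timorin: `Θ_n = Σ_a c_a π_{w_a^*}`, `c_a > 0`, in a `θ_n`-orthogonal basis (Chirka, tree
  `ofRealForm_neg_eq_sum_smul_principalTwoForm`); `0 = ∫ (Θ_0 ∧ ⋯ ∧ Θ_n) ∧ A ∧ Ā = Σ_a c_a κ_a · (HR quantity of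
  A|_{ker w_a^*})`, every term `σ`-non-negative, so every restriction vanishes, so `A = 0` by §4.

The induction itself (deformation to the classical case with T1, the mixed Lefschetz decomposition T2, and this
step) is the next file of the programme.

## Sources

* V. A. Timorin, *Mixed Hodge–Riemann bilinear relations in a linear context*, Funct. Anal. Appl. 32 (1998)
  268–272 — Main Theorem (not held; cited through Dinh–Nguyên). [Timorin1998]
* T.-C. Dinh, V.-A. Nguyên, *The mixed Hodge–Riemann bilinear relations for compact Kähler manifolds*, GAFA 16
  (2006), §1 Thm. 1.3 and the sentence before it ("using Aleksandrov's approach"), §2 Prop. 2.1 (arXiv PDF pp. 3, 5).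
  [DinhNguyen2006]
* Y. Shenfeld, R. van Handel, *Mixed volumes and the Bochner method*, Proc. AMS 147 (2019), §2.3 Lemma 2.6 (f)
  (rank-one argument = minors on the hyperplane), §4 Lemma 4.2 (induction on the dimension). [ShenfeldVanHandel2019]
* E. M. Chirka, *Complex Analytic Sets* (1989), App. A4.5 Positive forms, Example (d) (PDF pp. 336–338). [Chirka1989]
* H. Lange, *Abelian Varieties over the Complex Numbers* (2023), §1.1.1 (lattices of rank `2g`), §2.2.1 proof of
  Lemma 2.2.2 (`c_1 = (i/2) Σ h_μ dv_μ ∧ dv̄_μ`, the positive constant `c`). [Lange2023AbelianVarietiesComplex]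
* C. Voisin, *Hodge Theory and Complex Algebraic Geometry I* (2002), §7.3.2 (pull-back preserves the type `(p,q)`;
  PDF p. 150). [VoisinHodgeI2002]
* F. W. Warner, *Foundations of Differentiable Manifolds and Lie Groups*, GTM 94, 2.6 (the exterior algebra),
  2.10 (b). [WarnerGTM94]
-/

noncomputable section

open scoped ComplexConjugate ComplexOrder
open Complex Function Module
open Literature.LinearAlgebra.Alternating
open Literature.Analysis.Complex (oneForm₀ IsOfTypeAt typeSubmodule isOfTypeAt_of_mem_typeSubmodule)

namespace Literature.Geometry.Kaehler

namespace ComplexTorus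

/-! ## §1 Restriction of invariant forms along a complex-linear map (to a complex subspace) -/

section Restriction

variable {E F : Type*} [NormedAddCommGroup E] [NormedSpace ℂ E] [NormedAddCommGroup F] [NormedSpace ℂ F]

/-- Pull-back commutes with conjugation: `f^* ψ̄ = conj (f^* ψ)`. [cite: VoisinHodgeI2002, §2.3.1 (forms of type `(p,q)`; PDF p. 52) and §7.3.2 (PDF p. 150)] -/
theorem conjForm_compContinuousLinearMap {k : ℕ} (ψ : E [⋀^Fin k]→L[ℝ] ℂ) (f : F →L[ℝ] E) :
    conjForm (ψ.compContinuousLinearMap f) = (conjForm ψ).compContinuousLinearMap f := by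
  ext v; rfl

/-- `f^* Λ^{p,q}(E) ⊆ Λ^{p,q}(F)` for complex-linear `f` ("the pullback of such a form is still of type `(p,q)`";
tree `IsOfTypeAt.compContinuousLinearMap`). [cite: VoisinHodgeI2002, §7.3.2 (PDF p. 150)] -/
theorem compContinuousLinearMap_mem_typeSubmodule {k p q : ℕ} (hpq : p + q = k) {η : E [⋀^Fin k]→L[ℝ] ℂ}
    (hη : η ∈ typeSubmodule E k p q) (f : F →L[ℂ] E) :
    η.compContinuousLinearMap (f.restrictScalars ℝ) ∈ typeSubmodule F k p q :=
  ((isOfTypeAt_of_mem_typeSubmodule hpq hη).compContinuousLinearMap (f.restrictScalars ℝ)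
    fun c w ↦ f.map_smul c w).mem_typeSubmodule

/-- Reading a pair through a map: `g ∘ (x, y) = (g x, g y)`. [folklore] -/
private theorem comp_vecCons₂ {X Y : Type*} (g : X → Y) (x y : X) : (g ∘ ![x, y]) = ![g x, g y] := by
  funext i; fin_cases i <;> rfl

/-- The restriction of a real `(1,1)`-form to a complex subspace is of type `(1,1)`.
[cite: VoisinHodgeI2002, §7.3.2 (PDF p. 150)] [cite: Chirka1989, App. A4.5 (Positive forms; PDF pp. 336–337)] -/
theorem restrict_apply_I_smul (θ : E [⋀^Fin 2]→L[ℝ] ℝ) (S : Submodule ℂ E)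
    (h11 : ∀ x y : E, θ ![I • x, I • y] = θ ![x, y]) (x y : S) :
    θ.compContinuousLinearMap (S.subtypeL.restrictScalars ℝ) ![I • x, I • y] =
      θ.compContinuousLinearMap (S.subtypeL.restrictScalars ℝ) ![x, y] := by
  simp only [ContinuousAlternatingMap.compContinuousLinearMap_apply, comp_vecCons₂,
    ContinuousLinearMap.coe_restrictScalars', Submodule.subtypeL_apply, Submodule.coe_smul]
  exact h11 x y

/-- The restriction of a positive real `(1,1)`-form to a complex subspace is positive.
[cite: Chirka1989, App. A4.5 (Positive forms; PDF pp. 336–337)] -/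
theorem restrict_apply_I_smul_self_pos (θ : E [⋀^Fin 2]→L[ℝ] ℝ) (S : Submodule ℂ E)
    (hpos : ∀ v : E, v ≠ 0 → 0 < θ ![I • v, v]) (v : S) (hv : v ≠ 0) :
    0 < θ.compContinuousLinearMap (S.subtypeL.restrictScalars ℝ) ![I • v, v] := by
  simp only [ContinuousAlternatingMap.compContinuousLinearMap_apply, comp_vecCons₂,
    ContinuousLinearMap.coe_restrictScalars', Submodule.subtypeL_apply, Submodule.coe_smul]
  exact hpos v fun h ↦ hv (by exact_mod_cast h)

/-- The restriction of a semi-positive real `(1,1)`-form to a complex subspace is semi-positive.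
[cite: Chirka1989, App. A4.5 (Positive forms; PDF pp. 336–337)] -/
theorem restrict_apply_I_smul_self_nonneg (θ : E [⋀^Fin 2]→L[ℝ] ℝ) (S : Submodule ℂ E)
    (hpsd : ∀ v : E, 0 ≤ θ ![I • v, v]) (v : S) :
    0 ≤ θ.compContinuousLinearMap (S.subtypeL.restrictScalars ℝ) ![I • v, v] := by
  simp only [ContinuousAlternatingMap.compContinuousLinearMap_apply, comp_vecCons₂,
    ContinuousLinearMap.coe_restrictScalars', Submodule.subtypeL_apply, Submodule.coe_smul]
  exact hpsd v

/-- Restriction of the complexified negated family: `(f^*(-θ_j))_ℂ = f^*((-θ_j)_ℂ)`, family form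
(cf. tree `wedgeFamily_ofRealForm_neg_compContinuousLinearMap`). [cite: VoisinHodgeI2002, §7.3.2 (PDF p. 150)] -/
theorem ofRealForm_neg_family_compContinuousLinearMap {n : ℕ} (θ : Fin n → E [⋀^Fin 2]→L[ℝ] ℝ) (f : F →L[ℝ] E) :
    (fun j ↦ ofRealForm (-((θ j).compContinuousLinearMap f))) =
      fun j ↦ (ofRealForm (-(θ j))).compContinuousLinearMap f := by
  funext j
  ext v
  rfl

end Restriction

/-! ## §2 The complex orientation frame of a concatenated basis, and `(π_ξ ∧ Ψ)` on it -/

section Frame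

variable {E : Type*} [NormedAddCommGroup E] [NormedSpace ℂ E]

/-- **Interleaving commutes with concatenation**: the frame `(w₀, iw₀, …)` of `u₁ ++ u₂` is the frame of
`u₁` followed by the frame of `u₂` (up to the cast `2q + 2p = 2(q + p)`).
[cite: Lange2023AbelianVarietiesComplex, §1.7.2 Lemma 1.7.5] -/
theorem interleave_append {q p : ℕ} (u₁ : Fin q → E) (u₂ : Fin p → E) (h : 2 * q + 2 * p = 2 * (q + p)) :
    (fun i ↦ Sum.elim (Fin.append u₁ u₂) (fun j ↦ I • Fin.append u₁ u₂ j) (finTwoMulEquivSum (q + p) i)) ∘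
        Fin.cast h =
      Fin.append (fun i ↦ Sum.elim u₁ (fun j ↦ I • u₁ j) (finTwoMulEquivSum q i))
        (fun i ↦ Sum.elim u₂ (fun j ↦ I • u₂ j) (finTwoMulEquivSum p i)) := by
  funext x
  refine Fin.addCases (fun i ↦ ?_) (fun i ↦ ?_) x
  · rw [Function.comp_apply, Fin.append_left, finTwoMulEquivSum_cast_castAdd]
    cases finTwoMulEquivSum q i with
    | inl a => rw [Sum.map_inl, Sum.elim_inl, Sum.elim_inl, Fin.append_left]
    | inr a => rw [Sum.map_inr, Sum.elim_inr, Sum.elim_inr, Fin.append_left]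
  · rw [Function.comp_apply, Fin.append_right, finTwoMulEquivSum_cast_natAdd]
    cases finTwoMulEquivSum p i with
    | inl a => rw [Sum.map_inl, Sum.elim_inl, Sum.elim_inl, Fin.append_right]
    | inr a => rw [Sum.map_inr, Sum.elim_inr, Sum.elim_inr, Fin.append_right]

/-- The complex orientation frame of a single vector is `(v, iv)`. [cite: Lange2023AbelianVarietiesComplex, §1.7.2 Lemma 1.7.5] -/
theorem interleave_single (v : E) :
    (fun i ↦ Sum.elim ![v] (fun j ↦ I • ![v] j) (finTwoMulEquivSum 1 i)) = ![v, I • v] := by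
  funext i
  have hi2 : (i : ℕ) < 2 := by have := i.2; omega
  by_cases hi : (i : ℕ) % 2 = 0
  · rw [finTwoMulEquivSum_apply_of_even hi, Sum.elim_inl, Matrix.cons_val_fin_one]
    have hi0 : i = ⟨0, by omega⟩ := Fin.ext (by simp only; omega)
    rw [hi0]
    rfl
  · rw [finTwoMulEquivSum_apply_of_odd hi, Sum.elim_inr, Matrix.cons_val_fin_one]
    have hi1 : i = ⟨1, by omega⟩ := Fin.ext (by simp only; omega)
    rw [hi1]
    rfl

/-- The complex orientation frame of a family in a complex subspace, read in the ambient space.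
[cite: Lange2023AbelianVarietiesComplex, §1.7.2 Lemma 1.7.5] -/
theorem subtype_comp_interleave (S : Submodule ℂ E) {m : ℕ} (u : Fin m → S) :
    (S.subtype ∘ fun i ↦ Sum.elim u (fun j ↦ I • u j) (finTwoMulEquivSum m i)) =
      fun i ↦ Sum.elim (fun j ↦ (u j : E)) (fun j ↦ I • (u j : E)) (finTwoMulEquivSum m i) := by
  funext i
  rw [Function.comp_apply]
  cases finTwoMulEquivSum m i with
  | inl a => rw [Sum.elim_inl, Sum.elim_inl, Submodule.subtype_apply]
  | inr a => rw [Sum.elim_inr, Sum.elim_inr, Submodule.subtype_apply, Submodule.coe_smul]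

/-- `π_ξ` kills every pair containing a vector of `ker ξ`. [cite: Chirka1989, App. A4.5 (Positive forms)] -/
theorem principalTwoForm_apply_eq_zero_of_apply_eq_zero (ξ : E →L[ℂ] ℂ) (w : Fin 2 → E) (i : Fin 2)
    (hw : ξ (w i) = 0) : principalTwoForm ξ w = 0 := by
  have hw' : w = ![w 0, w 1] := by funext j; fin_cases j <;> rfl
  rw [hw', principalTwoForm_apply]
  fin_cases i
  · simp only [Fin.zero_eta] at hw
    rw [hw, Complex.zero_re, Complex.zero_im, zero_mul, mul_zero, sub_zero, Complex.ofReal_zero]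
  · simp only [Fin.mk_one] at hw
    rw [hw, Complex.zero_re, Complex.zero_im, zero_mul, mul_zero, sub_zero, Complex.ofReal_zero]

/-- **`(π_ξ ∧ Ψ)(v, iv, y₁, …, y_{2m}) = |ξ(v)|² · Ψ(y₁, …, y_{2m})` when all `yⱼ ∈ ker ξ`** (block evaluation
of the shuffle wedge: `π_ξ` kills every pair containing a `yⱼ`; the tree's Fubini-on-frames lemma
`wedge_apply_append_of_forall_eq_zero`). [cite: Chirka1989, App. A4.5 (Positive forms)] [cite: WarnerGTM94, 2.10 (b)] -/
theorem principalTwoForm_wedge_apply_append (ξ : E →L[ℂ] ℂ) {k : ℕ} (Ψ : E [⋀^Fin k]→L[ℝ] ℂ) (v : E)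
    (y : Fin k → E) (hy : ∀ j, ξ (y j) = 0) :
    ((principalTwoForm ξ).wedge Ψ) (Fin.append ![v, I • v] y) = ((Complex.normSq (ξ v) : ℝ) : ℂ) * Ψ y := by
  rw [wedge_apply_append_of_forall_eq_zero (principalTwoForm ξ) Ψ ![v, I • v] y
    (fun w i j hw ↦ principalTwoForm_apply_eq_zero_of_apply_eq_zero ξ w i (by rw [hw, hy])),
    principalTwoForm_apply_self_I_smul]

/-- **The hyperplane evaluation**: for a complex subspace `S ⊆ ker ξ`, a family `u` in `S` and a vector `v`,
`(π_ξ ∧ Ψ)` on the complex orientation frame of `v ++ u` is `|ξ(v)|²` times the RESTRICTION `Ψ|_S` on the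
complex orientation frame of `u` (read `(π_ξ ∧ Ψ) = (i/2) ξ ∧ ξ̄ ∧ Ψ` on `(v, iv, u₁, iu₁, …)`).
[cite: Chirka1989, App. A4.5 (Positive forms; PDF pp. 336–337)] [cite: ShenfeldVanHandel2019, §2.3 Lemma 2.6 (f)] -/
theorem principalTwoForm_wedge_apply_interleave_append (ξ : E →L[ℂ] ℂ) (S : Submodule ℂ E)
    (hS : ∀ x : S, ξ x = 0) {m : ℕ} (Ψ : E [⋀^Fin (2 * m)]→L[ℝ] ℂ) (v : E) (u : Fin m → S)
    (h : 2 * 1 + 2 * m = 2 * (1 + m)) :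
    ((principalTwoForm ξ).wedge Ψ) ((fun i ↦ Sum.elim (Fin.append ![v] (fun j ↦ (u j : E)))
        (fun j ↦ I • Fin.append ![v] (fun j ↦ (u j : E)) j) (finTwoMulEquivSum (1 + m) i)) ∘ Fin.cast h) =
      ((Complex.normSq (ξ v) : ℝ) : ℂ) *
        (Ψ.compContinuousLinearMap (S.subtypeL.restrictScalars ℝ))
          (fun i ↦ Sum.elim u (fun j ↦ I • u j) (finTwoMulEquivSum m i)) := by
  rw [interleave_append, interleave_single, principalTwoForm_wedge_apply_append ξ Ψ v _ (fun j ↦ ?_),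
    ContinuousAlternatingMap.compContinuousLinearMap_apply]
  · congr 1
    congr 1
    exact (subtype_comp_interleave S u).symm
  · cases finTwoMulEquivSum m j with
    | inl a => exact hS (u a)
    | inr a => rw [Sum.elim_inr, map_smul, hS (u a), smul_zero]

end Frame

/-! ## §3 `∫_X π_ξ ∧ Ψ = κ · ∫_{X_S} Ψ|_S` with `κ > 0`, for complex tori on `E` and on the hyperplane `S = ker ξ` -/

section Transfer

variable {ι ι' : Type*} [Fintype ι] [DecidableEq ι] [Fintype ι'] [DecidableEq ι']
  {E : Type*} [NormedAddCommGroup E] [NormedSpace ℂ E] (Φ : (ι → ℝ) ≃L[ℝ] E)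

/-- **A complex basis adapted to a hyperplane**: for a complex subspace `S ⊆ ker ξ` of dimension `m` in `E` of
dimension `1 + m`, a basis `u` of `S` and a vector `v` with `ξ(v) ≠ 0`, the family `v ++ u` is a basis of `E`
(`v ∉ S ⊇ span u`; the basis `e_i, (e_j)_{j ≠ i}` adapted to the hyperplane `e_i^⊥` of Shenfeld–van Handel's minors
`M^{⟨i⟩}`). [cite: ShenfeldVanHandel2019, §2.3 Lemma 2.6 (f)] -/
theorem linearIndependent_append_single_of_apply_ne_zero (ξ : E →L[ℂ] ℂ) (S : Submodule ℂ E)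
    (hS : ∀ x : S, ξ x = 0) {m : ℕ} (u : Module.Basis (Fin m) ℂ S) {v : E} (hv : ξ v ≠ 0) :
    LinearIndependent ℂ (Fin.append ![v] (fun j ↦ (u j : E))) := by
  have hli : LinearIndependent ℂ (fun j ↦ (u j : E)) :=
    u.linearIndependent.map' S.subtype (Submodule.ker_subtype S)
  have hv' : v ∉ Submodule.span ℂ (Set.range fun j ↦ (u j : E)) := by
    intro hmem
    have hle : Submodule.span ℂ (Set.range fun j ↦ (u j : E)) ≤ S :=
      Submodule.span_le.2 (by rintro _ ⟨j, rfl⟩; exact (u j).2)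
    exact hv (hS ⟨v, hle hmem⟩)
  have hcons := hli.finCons hv'
  rw [Fin.append_left_eq_cons]
  exact hcons.comp _ (Fin.cast_injective _)

include Φ in
/-- **`∫_X π_ξ ∧ Ψ = κ · ∫_{X_S} Ψ|_S` with one constant `κ > 0` for all `Ψ`**: for complex tori `X = E/Λ`
(dimension `1 + m`) and `X_S = S/Λ_S` on a complex hyperplane `S ⊆ ker ξ` (dimension `m`, `ξ ≠ 0` on `E`), the
integral of `π_ξ ∧ Ψ` over `X` is a fixed positive multiple of the integral of the restriction `Ψ|_S` over
`X_S` — both are the values on complex orientation frames divided by positive volumes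
(`apply_interleave_eq_torusIntegral_mul`), and `(π_ξ ∧ Ψ)(v, iv, u, iu, …) = |ξ(v)|² Ψ|_S(u, iu, …)`. This is the
form in which "restriction to a hyperplane" enters the induction on the dimension for constant-coefficient forms.
[cite: ShenfeldVanHandel2019, §2.3 Lemma 2.6 (f) and §4 Lemma 4.2 (induction on the dimension)] [cite: Timorin1998, Main Theorem]
[cite: Lange2023AbelianVarietiesComplex, §2.2.1 proof of Lemma 2.2.2] -/
theorem exists_pos_torusIntegral_principalTwoForm_wedge_eq_mul {n m : ℕ} (e : Fin (2 * n) ≃ ι) (hn : 1 + m = n)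
    (S : Submodule ℂ E) (ΦS : (ι' → ℝ) ≃L[ℝ] S) (eS : Fin (2 * m) ≃ ι') (ξ : E →L[ℂ] ℂ) (hS : ∀ x : S, ξ x = 0)
    (hξ : ξ ≠ 0) (h2 : 2 + 2 * m = 2 * n) :
    ∃ κ : ℝ, 0 < κ ∧ ∀ Ψ : E [⋀^Fin (2 * m)]→L[ℝ] ℂ,
      torusIntegral Φ e (((principalTwoForm ξ).wedge Ψ).domDomCongr (finCongr h2)) =
        κ * torusIntegral ΦS eS (Ψ.compContinuousLinearMap (S.subtypeL.restrictScalars ℝ)) := by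
  subst hn
  haveI := finiteDimensional_complex Φ
  haveI := finiteDimensional_complex ΦS
  have hE : finrank ℂ E = 1 + m := finrank_eq_of_finTwoMulEquiv Φ e
  have hSm : finrank ℂ S = m := finrank_eq_of_finTwoMulEquiv ΦS eS
  -- a vector off the hyperplane and an adapted complex basis `v ++ u`
  obtain ⟨v, hv⟩ : ∃ v : E, ξ v ≠ 0 := by
    by_contra h
    push Not at h
    exact hξ (ContinuousLinearMap.ext fun x ↦ by rw [h x]; rfl)
  set u : Module.Basis (Fin m) ℂ S := Module.finBasisOfFinrankEq ℂ S hSm with hu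
  have hli := linearIndependent_append_single_of_apply_ne_zero ξ S hS u hv
  set uE : Module.Basis (Fin (1 + m)) ℂ E :=
    basisOfLinearIndependentOfCardEqFinrank hli (by rw [Fintype.card_fin, hE]) with huE
  have huE' : ⇑uE = Fin.append ![v] (fun j ↦ (u j : E)) := by
    rw [huE, coe_basisOfLinearIndependentOfCardEqFinrank]
  obtain ⟨rE, hrE, hvolE⟩ := exists_volumeForm_apply_interleave_eq Φ e uE
  obtain ⟨rS, hrS, hvolS⟩ := exists_volumeForm_apply_interleave_eq ΦS eS u
  refine ⟨Complex.normSq (ξ v) * rS / rE, div_pos (mul_pos (Complex.normSq_pos.2 hv) hrS) hrE, fun Ψ ↦ ?_⟩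
  have hEval := apply_interleave_eq_torusIntegral_mul Φ e uE
    (((principalTwoForm ξ).wedge Ψ).domDomCongr (finCongr h2))
  have hSval := apply_interleave_eq_torusIntegral_mul ΦS eS u
    (Ψ.compContinuousLinearMap (S.subtypeL.restrictScalars ℝ))
  rw [hvolE, ContinuousAlternatingMap.domDomCongr_apply, huE'] at hEval
  rw [hvolS] at hSval
  have hkey := principalTwoForm_wedge_apply_interleave_append ξ S hS Ψ v u h2
  have hcast : ((fun i ↦ Sum.elim (Fin.append ![v] (fun j ↦ (u j : E)))
      (fun j ↦ I • Fin.append ![v] (fun j ↦ (u j : E)) j) (finTwoMulEquivSum (1 + m) i)) ∘ ⇑(finCongr h2)) =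
      ((fun i ↦ Sum.elim (Fin.append ![v] (fun j ↦ (u j : E)))
        (fun j ↦ I • Fin.append ![v] (fun j ↦ (u j : E)) j) (finTwoMulEquivSum (1 + m) i)) ∘ Fin.cast h2) := rfl
  rw [hcast, hkey, hSval] at hEval
  -- `hEval : |ξ v|² (∫_S Ψ|_S · rS) = ∫_E (π ∧ Ψ) · rE`
  have hrE' : (rE : ℂ) ≠ 0 := by exact_mod_cast hrE.ne'
  rw [show ((Complex.normSq (ξ v) * rS / rE : ℝ) : ℂ) = (Complex.normSq (ξ v) : ℂ) * rS / rE by push_cast; ring,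
    eq_comm, div_mul_eq_mul_div, div_eq_iff hrE']
  linear_combination hEval

end Transfer

/-! ## §4 A form of degree `< dim E` vanishing on all the coordinate hyperplanes of a complex basis vanishes -/

section Vanishing

variable {E : Type*} [NormedAddCommGroup E] [NormedSpace ℂ E]

/-- **A `k`-form with `k < dim_ℂ E` whose restrictions to the `n` coordinate hyperplanes `ker w_j^*` of a complex
basis `w` all vanish is zero**: any `k` vectors of the real basis `(w_a, i w_a)` involve at most `k < n` indices
`a`, so they all lie in some `ker w_j^*` (a form is determined by its values on tuples of vectors of a real basis,
`Alt^k_ℝ(V, ℂ) = ⋀^k Hom_ℝ(V, ℂ)`). [cite: Lange2023AbelianVarietiesComplex, §1.1.3 Cor. 1.1.19]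
[cite: ShenfeldVanHandel2019, §4 Lemma 4.2 (summing over the coordinate hyperplanes `e_i^⊥`)] -/
theorem eq_zero_of_forall_compContinuousLinearMap_ker_coord_eq_zero [FiniteDimensional ℂ E] {n k : ℕ}
    (w : Module.Basis (Fin n) ℂ E) (hk : k < n) (α : E [⋀^Fin k]→L[ℝ] ℂ)
    (h : ∀ j : Fin n, α.compContinuousLinearMap
      ((LinearMap.ker (basisCoordCLM w j).toLinearMap).subtypeL.restrictScalars ℝ) = 0) : α = 0 := by
  classical
  apply ContinuousAlternatingMap.toAlternatingMap_injective
  rw [ContinuousAlternatingMap.toAlternatingMap_zero]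
  refine Module.Basis.ext_alternating (Complex.basisOneI.smulTower' w) fun v hv ↦ ?_
  rw [AlternatingMap.zero_apply, ContinuousAlternatingMap.coe_toAlternatingMap]
  -- an index `j` not used by the tuple
  obtain ⟨j, -, hj⟩ : ∃ j, j ∈ (Finset.univ : Finset (Fin n)) ∧ j ∉ Finset.univ.image (fun i ↦ (v i).1) := by
    apply Finset.exists_mem_notMem_of_card_lt_card
    calc (Finset.univ.image (fun i ↦ (v i).1)).card ≤ (Finset.univ : Finset (Fin k)).card := Finset.card_image_le
      _ = k := Finset.card_fin k
      _ < n := hk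
      _ = (Finset.univ : Finset (Fin n)).card := (Finset.card_fin n).symm
  have hmem : ∀ i, (Complex.basisOneI.smulTower' w) (v i) ∈ LinearMap.ker (basisCoordCLM w j).toLinearMap := by
    intro i
    rw [LinearMap.mem_ker, Module.Basis.smulTower'_apply, ContinuousLinearMap.coe_coe, map_smul, basisCoordCLM_apply,
      w.repr_self, Finsupp.single_apply, if_neg, smul_zero]
    intro hji
    exact hj (Finset.mem_image.2 ⟨i, Finset.mem_univ _, hji⟩)
  have h0 := congrArg (fun β ↦ β (fun i ↦ ⟨_, hmem i⟩)) (h j)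
  simp only [ContinuousAlternatingMap.compContinuousLinearMap_apply, ContinuousAlternatingMap.coe_zero,
    Pi.zero_apply] at h0
  exact h0

end Vanishing

/-! ## §5 The last background form moved to the front; restriction of the mixed Hodge–Riemann integrand -/

section Reorder

variable {E F : Type*} [NormedAddCommGroup E] [NormedSpace ℂ E] [NormedAddCommGroup F] [NormedSpace ℂ F]

/-- **`(θ_1 ∧ ⋯ ∧ θ_r ∧ π) ∧ B = π ∧ ((θ_1 ∧ ⋯ ∧ θ_r) ∧ B)`** up to the casts of degrees: `2`-forms are central in the
exterior algebra (computed in the ring of graded forms). [cite: WarnerGTM94, 2.6] -/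
theorem wedgeFamily_snoc_wedge_eq_domDomCongr {r k m : ℕ} (Θ : Fin r → E [⋀^Fin 2]→L[ℝ] ℂ)
    (π : E [⋀^Fin 2]→L[ℝ] ℂ) (B : E [⋀^Fin k]→L[ℝ] ℂ) (hk : 2 * r + k = 2 * m) (h : 2 + 2 * m = 2 * (r + 1) + k) :
    (wedgeFamily (r + 1) (Fin.snoc Θ π)).wedge B =
      (π.wedge (((wedgeFamily r Θ).wedge B).domDomCongr (finCongr hk))).domDomCongr (finCongr h) := by
  refine GForm.of_injective (2 * (r + 1) + k) ?_
  simp only [GForm.of_domDomCongr_finCongr, ← GForm.of_mul_of]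
  rw [gof_wedgeFamily_succ, Fin.init_snoc, Fin.snoc_last, ← GForm.of_mul_comm_of_even even_two π, mul_assoc]

/-- **Restriction is a ring map on the integrand**: `((θ_1 ∧ ⋯ ∧ θ_r) ∧ B) ∘ f = (f^*θ_1 ∧ ⋯ ∧ f^*θ_r) ∧ f^*B`
(tree `wedge_compContinuousLinearMap`, `wedgeFamily_compContinuousLinearMap`). [cite: WarnerGTM94, 2.10 (b)] -/
theorem wedgeFamily_wedge_compContinuousLinearMap {r k : ℕ} (Θ : Fin r → E [⋀^Fin 2]→L[ℝ] ℂ)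
    (B : E [⋀^Fin k]→L[ℝ] ℂ) (f : F →L[ℝ] E) :
    ((wedgeFamily r Θ).wedge B).compContinuousLinearMap f =
      (wedgeFamily r fun j ↦ (Θ j).compContinuousLinearMap f).wedge (B.compContinuousLinearMap f) := by
  rw [ContinuousAlternatingMap.wedge_compContinuousLinearMap, wedgeFamily_compContinuousLinearMap]

/-- `(A ∧ Ā) ∘ f = (A ∘ f) ∧ conj (A ∘ f)`. [cite: VoisinHodgeI2002, §7.3.2 (pull-back of forms; PDF p. 150)] -/
theorem wedge_conjForm_compContinuousLinearMap {k : ℕ} (A : E [⋀^Fin k]→L[ℝ] ℂ) (f : F →L[ℝ] E) :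
    (A.wedge (conjForm A)).compContinuousLinearMap f =
      (A.compContinuousLinearMap f).wedge (conjForm (A.compContinuousLinearMap f)) := by
  rw [ContinuousAlternatingMap.wedge_compContinuousLinearMap, conjForm_compContinuousLinearMap]

/-- The mixed primitivity condition restricts: `(θ_1 ∧ ⋯ ∧ θ_r) ∧ A = 0 ⇒ (θ_1|_F ∧ ⋯ ∧ θ_r|_F) ∧ A|_F = 0`.
[cite: ShenfeldVanHandel2019, §4 Lemma 4.2 (induction on the dimension)] -/
theorem wedgeFamily_wedge_compContinuousLinearMap_eq_zero {r k : ℕ} {Θ : Fin r → E [⋀^Fin 2]→L[ℝ] ℂ}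
    {A : E [⋀^Fin k]→L[ℝ] ℂ} (h : (wedgeFamily r Θ).wedge A = 0) (f : F →L[ℝ] E) :
    (wedgeFamily r fun j ↦ (Θ j).compContinuousLinearMap f).wedge (A.compContinuousLinearMap f) = 0 := by
  rw [← wedgeFamily_wedge_compContinuousLinearMap, h]
  ext v
  rfl

end Reorder

/-! ## §6 The hyperplane evaluation of the mixed Hodge–Riemann integrand -/

section FrameTransfer

variable {E : Type*} [NormedAddCommGroup E] [NormedSpace ℂ E]

/-- **The hyperplane evaluation of `(θ_1 ∧ ⋯ ∧ θ_r ∧ π_ξ) ∧ B`**: for a complex subspace `S ⊆ ker ξ`, a family `u`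
in `S` and a vector `v`, the integrand with last background form `π_ξ`, read on the complex orientation frame of
`v ++ u`, is `|ξ(v)|²` times the RESTRICTED integrand `(θ_1|_S ∧ ⋯ ∧ θ_r|_S) ∧ B|_S` read on the complex orientation
frame of `u` — the form-level version of `D(e_i e_i^*, M_2, …) = c · D(M_2^{⟨i⟩}, …)` (wedging with the rank-one
form of a functional = restricting the other arguments to its kernel).
[cite: ShenfeldVanHandel2019, §2.3 Lemma 2.6 (f)] [cite: Chirka1989, App. A4.5 (Positive forms; PDF p. 336)] -/
theorem wedgeFamily_snoc_principalTwoForm_wedge_apply_interleave_append (ξ : E →L[ℂ] ℂ) (S : Submodule ℂ E)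
    (hS : ∀ x : S, ξ x = 0) {r k m : ℕ} (Θ : Fin r → E [⋀^Fin 2]→L[ℝ] ℂ) (B : E [⋀^Fin k]→L[ℝ] ℂ) (v : E)
    (u : Fin m → S) (hk : 2 * r + k = 2 * m) (h : 2 * (r + 1) + k = 2 * (1 + m)) :
    ((wedgeFamily (r + 1) (Fin.snoc Θ (principalTwoForm ξ))).wedge B)
        ((fun i ↦ Sum.elim (Fin.append ![v] (fun j ↦ (u j : E)))
          (fun j ↦ I • Fin.append ![v] (fun j ↦ (u j : E)) j) (finTwoMulEquivSum (1 + m) i)) ∘ Fin.cast h) =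
      ((Complex.normSq (ξ v) : ℝ) : ℂ) *
        ((wedgeFamily r fun j ↦ (Θ j).compContinuousLinearMap (S.subtypeL.restrictScalars ℝ)).wedge
          (B.compContinuousLinearMap (S.subtypeL.restrictScalars ℝ)))
          ((fun i ↦ Sum.elim u (fun j ↦ I • u j) (finTwoMulEquivSum m i)) ∘ Fin.cast hk) := by
  have h' : 2 + 2 * m = 2 * (r + 1) + k := by omega
  have h1 : 2 * 1 + 2 * m = 2 * (1 + m) := by ring
  rw [wedgeFamily_snoc_wedge_eq_domDomCongr Θ (principalTwoForm ξ) B hk h',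
    ContinuousAlternatingMap.domDomCongr_apply]
  have hcast : (((fun i ↦ Sum.elim (Fin.append ![v] (fun j ↦ (u j : E)))
      (fun j ↦ I • Fin.append ![v] (fun j ↦ (u j : E)) j) (finTwoMulEquivSum (1 + m) i)) ∘ Fin.cast h) ∘
        ⇑(finCongr h')) =
      ((fun i ↦ Sum.elim (Fin.append ![v] (fun j ↦ (u j : E)))
        (fun j ↦ I • Fin.append ![v] (fun j ↦ (u j : E)) j) (finTwoMulEquivSum (1 + m) i)) ∘ Fin.cast h1) := rfl
  rw [hcast, principalTwoForm_wedge_apply_interleave_append ξ S hS _ v u h1,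
    domDomCongr_finCongr_compContinuousLinearMap, ContinuousAlternatingMap.domDomCongr_apply,
    wedgeFamily_wedge_compContinuousLinearMap]
  rfl

end FrameTransfer

/-! ## §7 `∫_X (θ_1 ∧ ⋯ ∧ θ_r ∧ π_ξ) ∧ B = κ · ∫_{X_S} (θ_1|_S ∧ ⋯ ∧ θ_r|_S) ∧ B|_S`, `κ > 0` -/

section TorusTransfer

variable {ι ι' : Type*} [Fintype ι] [DecidableEq ι] [Fintype ι'] [DecidableEq ι']
  {E : Type*} [NormedAddCommGroup E] [NormedSpace ℂ E] (Φ : (ι → ℝ) ≃L[ℝ] E)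

include Φ in
/-- **The hyperplane transfer of mixed intersection numbers**: for complex tori `X = E/Λ` (dimension `1 + m`) and
`X_S` on a complex hyperplane `S ⊆ ker ξ` (dimension `m`, `ξ ≠ 0`), there is ONE constant `κ > 0` with
`∫_X (θ_1 ∧ ⋯ ∧ θ_r ∧ π_ξ) ∧ B = κ · ∫_{X_S} (θ_1|_S ∧ ⋯ ∧ θ_r|_S) ∧ B|_S` for all backgrounds `θ` and all `B`
(Lemma 2.6 (f) of Shenfeld–van Handel for mixed discriminants, `D(e_i e_i^*, M_2, …) = c · D(M_2^{⟨i⟩}, …)`, in the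
language of constant-coefficient forms of any bidegree). [cite: ShenfeldVanHandel2019, §2.3 Lemma 2.6 (f)]
[cite: Timorin1998, Main Theorem (the linear mixed Hodge–Riemann relations, proved "using Aleksandrov's approach")] -/
theorem exists_pos_torusIntegral_wedgeFamily_snoc_principalTwoForm_wedge_eq_mul {n m : ℕ} (e : Fin (2 * n) ≃ ι)
    (hn : 1 + m = n) (S : Submodule ℂ E) (ΦS : (ι' → ℝ) ≃L[ℝ] S) (eS : Fin (2 * m) ≃ ι') (ξ : E →L[ℂ] ℂ)
    (hS : ∀ x : S, ξ x = 0) (hξ : ξ ≠ 0) {r k : ℕ} (hk : 2 * r + k = 2 * m) (h : 2 * (r + 1) + k = 2 * n) :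
    ∃ κ : ℝ, 0 < κ ∧ ∀ (Θ : Fin r → E [⋀^Fin 2]→L[ℝ] ℂ) (B : E [⋀^Fin k]→L[ℝ] ℂ),
      torusIntegral Φ e (((wedgeFamily (r + 1) (Fin.snoc Θ (principalTwoForm ξ))).wedge B).domDomCongr
          (finCongr h)) =
        κ * torusIntegral ΦS eS (((wedgeFamily r fun j ↦ (Θ j).compContinuousLinearMap
          (S.subtypeL.restrictScalars ℝ)).wedge (B.compContinuousLinearMap (S.subtypeL.restrictScalars ℝ))).domDomCongr
            (finCongr hk)) := by
  have h2 : 2 + 2 * m = 2 * n := by omega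
  obtain ⟨κ, hκ, hall⟩ := exists_pos_torusIntegral_principalTwoForm_wedge_eq_mul Φ e hn S ΦS eS ξ hS hξ h2
  refine ⟨κ, hκ, fun Θ B ↦ ?_⟩
  have h' : 2 + 2 * m = 2 * (r + 1) + k := by omega
  rw [wedgeFamily_snoc_wedge_eq_domDomCongr Θ (principalTwoForm ξ) B hk h', domDomCongr_finCongr_trans, hall,
    domDomCongr_finCongr_compContinuousLinearMap, wedgeFamily_wedge_compContinuousLinearMap]

end TorusTransfer

/-! ## §8 Data of a complex hyperplane: dimension of `ker ξ`, the coordinate functionals, a real-linear chart -/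

section KernelData

variable {E : Type*} [NormedAddCommGroup E] [NormedSpace ℂ E]

/-- `dim_ℂ ker ξ + 1 = dim_ℂ E` for a non-zero functional. [cite: ShenfeldVanHandel2019, §2.3 Lemma 2.6 (f)] -/
theorem finrank_ker_add_one_eq_of_ne_zero [FiniteDimensional ℂ E] (ξ : E →L[ℂ] ℂ) (hξ : ξ ≠ 0) :
    finrank ℂ (LinearMap.ker ξ.toLinearMap) + 1 = finrank ℂ E :=
  Module.Dual.finrank_ker_add_one_of_ne_zero (f := ξ.toLinearMap) fun h ↦ hξ (by
    ext x; exact congrArg (fun f : E →ₗ[ℂ] ℂ ↦ f x) h)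

/-- The coordinate functional `w_a^*` takes the value `1` at `w_a`. [cite: Chirka1989, App. A4.5 Example (d) (PDF p. 336)] -/
theorem basisCoordCLM_apply_self {g : ℕ} [FiniteDimensional ℂ E] (w : Module.Basis (Fin g) ℂ E) (a : Fin g) :
    basisCoordCLM w a (w a) = 1 := by
  rw [basisCoordCLM_apply, w.repr_self, Finsupp.single_eq_same]

/-- The coordinate functionals of a basis are non-zero. [cite: Chirka1989, App. A4.5 Example (d) (PDF p. 336)] -/
theorem basisCoordCLM_ne_zero {g : ℕ} [FiniteDimensional ℂ E] (w : Module.Basis (Fin g) ℂ E) (a : Fin g) :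
    basisCoordCLM w a ≠ 0 := fun h ↦ by
  have h1 := basisCoordCLM_apply_self w a
  rw [h] at h1
  simp at h1

/-- The coordinate hyperplanes `ker w_a^*` of a complex basis have dimension `dim E - 1`.
[cite: ShenfeldVanHandel2019, §2.3 Lemma 2.6 (f) (the minors `M^{⟨i⟩}`)] -/
theorem finrank_ker_basisCoordCLM_add_one {g : ℕ} [FiniteDimensional ℂ E] (w : Module.Basis (Fin g) ℂ E) (a : Fin g) :
    finrank ℂ (LinearMap.ker (basisCoordCLM w a).toLinearMap) + 1 = g := by
  rw [finrank_ker_add_one_eq_of_ne_zero _ (basisCoordCLM_ne_zero w a), finrank_eq_card_basis w, Fintype.card_fin]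

/-- **A real-linear chart `ℝ^{2m} ≃ F` of a complex vector space of dimension `m`** (a complex torus structure on
`F`, used to read top forms on `F` through `∫`). [cite: Lange2023AbelianVarietiesComplex, §1.1.1 (Definition of Complex Tori: a lattice in `V` has rank `2g`)] -/
theorem nonempty_continuousLinearEquiv_of_finrank_eq {F : Type*} [NormedAddCommGroup F] [NormedSpace ℂ F]
    [FiniteDimensional ℂ F] {m : ℕ} (h : finrank ℂ F = m) : Nonempty ((Fin (2 * m) → ℝ) ≃L[ℝ] F) := by
  haveI : FiniteDimensional ℝ F := FiniteDimensional.complexToReal F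
  have h2 : finrank ℝ (Fin (2 * m) → ℝ) = finrank ℝ F := by
    rw [Module.finrank_fintype_fun_eq_card, Fintype.card_fin, finrank_real_of_complex, h]
  exact ⟨ContinuousLinearEquiv.ofFinrankEq h2⟩

end KernelData

/-! ## §9 Timorin's hyperplane step: mixed Hodge–Riemann on the coordinate hyperplanes ⇒ mixed hard Lefschetz -/

section HyperplaneStep

variable {E : Type*} [NormedAddCommGroup E] [NormedSpace ℂ E]

/-- `∫` of a reindexed linear combination. [folklore] -/
private theorem torusIntegral_domDomCongr_sum_smul {ι : Type*} [Fintype ι] [DecidableEq ι] (Φ : (ι → ℝ) ≃L[ℝ] E)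
    {N N' : ℕ} (e : Fin N' ≃ ι) (h : N = N') {κ : Type*} (s : Finset κ) (c : κ → ℝ)
    (T : κ → E [⋀^Fin N]→L[ℝ] ℂ) :
    torusIntegral Φ e ((∑ a ∈ s, c a • T a).domDomCongr (finCongr h)) =
      ∑ a ∈ s, (c a : ℂ) * torusIntegral Φ e ((T a).domDomCongr (finCongr h)) := by
  simp only [torusIntegral, ContinuousAlternatingMap.domDomCongr_apply, ContinuousAlternatingMap.sum_apply,
    ContinuousAlternatingMap.smul_apply, Complex.real_smul, Finset.mul_sum]
  exact Finset.sum_congr rfl fun a _ ↦ by ring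

/-- **Timorin's hyperplane step (mixed Hodge–Riemann in dimension `g - 1` ⇒ mixed hard Lefschetz in dimension
`g`).** Let `dim_ℂ E = g = n + 1 + k`, `k = p + q`, and let `θ_0, …, θ_n` be real `2`-forms with `θ_n` of type
`(1,1)` and positive (`θ_n(iv, v) > 0`); write `Θ_j = (-θ_j)_ℂ`. Suppose that on every complex subspace `S` of
dimension `n + k` the mixed Hodge–Riemann inequality holds for the restricted data in the frame form: for
`0 ≠ A' ∈ Λ^{p,q}(S)` with `(Θ_0|_S ∧ ⋯ ∧ Θ_n|_S) ∧ A' = 0` and every complex basis `u` of `S`,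
`σ · ((Θ_0|_S ∧ ⋯ ∧ Θ_{n-1}|_S) ∧ A' ∧ Ā')(u_1, iu_1, …) > 0`. Then `(Θ_0 ∧ ⋯ ∧ Θ_n) ∧ A = 0` forces `A = 0`
for `A ∈ Λ^{p,q}(E)`. Proof (Aleksandrov's induction, as used by Timorin; the `(1,1)` case is Shenfeld–van Handel's
Lemma 4.2): write `Θ_n = Σ_a c_a π_{w_a^*}` with `c_a > 0` in a `θ_n`-orthogonal basis `w` (Chirka); then
`0 = Σ_a c_a ∫ (Θ_0 ∧ ⋯ ∧ Θ_{n-1} ∧ π_{w_a^*}) ∧ A ∧ Ā = Σ_a c_a κ_a · (HR quantity of A|_{ker w_a^*})` with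
`κ_a > 0` (§6) and every term `σ`-non-negative by hypothesis (the restrictions are primitive), so all vanish, so
`A|_{ker w_a^*} = 0` for all `a`, so `A = 0` (`k < g`, §4).
[cite: Timorin1998, Main Theorem (proof "using Aleksandrov's approach", cf. DinhNguyen2006 §1 before Thm. 1.3)]
[cite: ShenfeldVanHandel2019, §4 Lemma 4.2 and §2.3 Lemma 2.6 (f)] [cite: DinhNguyen2006, §2 Prop. 2.1 (a) (arXiv PDF p. 5)] -/
theorem eq_zero_of_wedgeFamily_wedge_eq_zero_of_hyperplanes [FiniteDimensional ℂ E] {g n k p q : ℕ}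
    (hg : finrank ℂ E = g) (hnk : n + 1 + k = g) (hpq : p + q = k) (hc : 2 * n + (k + k) = 2 * (n + k))
    (θ : Fin (n + 1) → E [⋀^Fin 2]→L[ℝ] ℝ)
    (h11 : ∀ x y : E, θ (Fin.last n) ![I • x, I • y] = θ (Fin.last n) ![x, y])
    (hpos : ∀ v : E, v ≠ 0 → 0 < θ (Fin.last n) ![I • v, v]) (σ : ℂ)
    (hHR : ∀ (S : Submodule ℂ E) (uS : Module.Basis (Fin (n + k)) ℂ S) (A' : S [⋀^Fin k]→L[ℝ] ℂ),
      A' ∈ typeSubmodule S k p q →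
      (wedgeFamily (n + 1) fun j ↦ ofRealForm (-((θ j).compContinuousLinearMap
        (S.subtypeL.restrictScalars ℝ)))).wedge A' = 0 →
      A' ≠ 0 →
      0 < σ * ((wedgeFamily n fun j ↦ ofRealForm (-((θ (Fin.castSucc j)).compContinuousLinearMap
          (S.subtypeL.restrictScalars ℝ)))).wedge (A'.wedge (conjForm A')))
          ((fun i ↦ Sum.elim (⇑uS) (fun j ↦ I • uS j) (finTwoMulEquivSum (n + k) i)) ∘ Fin.cast hc))
    {A : E [⋀^Fin k]→L[ℝ] ℂ} (hA : A ∈ typeSubmodule E k p q)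
    (h0 : (wedgeFamily (n + 1) fun j ↦ ofRealForm (-(θ j))).wedge A = 0) : A = 0 := by
  classical
  -- Chirka: `Θ_n = Σ_a c_a π_{w_a^*}` with all `c_a > 0`
  obtain ⟨w, c, horth⟩ := exists_basis_hermOf_orthogonal_diag (θ (Fin.last n)) h11 hg
  have hc_pos : ∀ a, 0 < c a := diag_pos_of_orthogonal _ hpos w c horth
  have hdec := ofRealForm_neg_eq_sum_smul_principalTwoForm (θ (Fin.last n)) h11 w c horth
  -- notation
  set Θ : Fin (n + 1) → E [⋀^Fin 2]→L[ℝ] ℂ := fun j ↦ ofRealForm (-(θ j)) with hΘ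
  set Θ' : Fin n → E [⋀^Fin 2]→L[ℝ] ℂ := fun j ↦ ofRealForm (-(θ (Fin.castSucc j))) with hΘ'
  set B : E [⋀^Fin (k + k)]→L[ℝ] ℂ := A.wedge (conjForm A) with hB
  set T : Fin g → E [⋀^Fin (2 * (n + 1) + (k + k))]→L[ℝ] ℂ :=
    fun a ↦ (wedgeFamily (n + 1) (Fin.snoc Θ' (principalTwoForm (basisCoordCLM w a)))).wedge B with hT
  -- (1) `Σ_a c_a T_a = 0`, from `Ω ∧ A = 0` in the ring of graded forms
  have hsmulC : ∀ (t : ℝ) (η : E [⋀^Fin 2]→L[ℝ] ℂ), (t : ℂ) • η = t • η := fun t η ↦ by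
    ext v; simp only [ContinuousAlternatingMap.smul_apply, Complex.real_smul, smul_eq_mul]
  have hsum : ∑ a, c a • T a = 0 := by
    refine GForm.of_injective (2 * (n + 1) + (k + k)) ?_
    rw [GForm.of_sum, GForm.of_zero]
    have hterm : ∀ a, GForm.of (2 * (n + 1) + (k + k)) (c a • T a) =
        c a • (GForm.of (2 * n) (wedgeFamily n Θ') * GForm.of 2 (principalTwoForm (basisCoordCLM w a)) *
          GForm.of (k + k) B) := fun a ↦ by
      rw [GForm.of_smul, hT]
      simp only
      rw [← GForm.of_mul_of, gof_wedgeFamily_succ, Fin.init_snoc, Fin.snoc_last]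
    have hlast : GForm.of 2 (Θ (Fin.last n)) = ∑ a, c a • GForm.of 2 (principalTwoForm (basisCoordCLM w a)) := by
      show GForm.of 2 (ofRealForm (-(θ (Fin.last n)))) = _
      rw [hdec, GForm.of_sum]
      exact Finset.sum_congr rfl fun a _ ↦ by rw [hsmulC, GForm.of_smul]
    have hinit : Fin.init Θ = Θ' := rfl
    have h0' : GForm.of (2 * (n + 1)) (wedgeFamily (n + 1) Θ) * GForm.of k A = 0 := by
      rw [GForm.of_mul_of, h0, GForm.of_zero]
    calc ∑ a, GForm.of (2 * (n + 1) + (k + k)) (c a • T a)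
        = ∑ a, c a • (GForm.of (2 * n) (wedgeFamily n Θ') * GForm.of 2 (principalTwoForm (basisCoordCLM w a)) *
            GForm.of (k + k) B) := Finset.sum_congr rfl fun a _ ↦ hterm a
      _ = GForm.of (2 * n) (wedgeFamily n Θ') * (∑ a, c a • GForm.of 2 (principalTwoForm (basisCoordCLM w a))) *
            GForm.of (k + k) B := by
          rw [Finset.mul_sum, Finset.sum_mul]
          refine Finset.sum_congr rfl fun a _ ↦ ?_
          rw [GForm.mul_smul, GForm.smul_mul]
      _ = GForm.of (2 * (n + 1)) (wedgeFamily (n + 1) Θ) * GForm.of (k + k) B := by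
          rw [← hlast, gof_wedgeFamily_succ, hinit]
      _ = 0 := by rw [hB, ← GForm.of_mul_of k k, ← mul_assoc, h0', zero_mul]
  -- (2) an auxiliary complex torus structure on `E`, and the vanishing of `Σ_a c_a ∫ T_a`
  have hm : finrank ℂ E = 1 + (n + k) := by rw [hg]; omega
  obtain ⟨Φ0⟩ := nonempty_continuousLinearEquiv_of_finrank_eq (F := E) hm
  have h2 : 2 * (n + 1) + (k + k) = 2 * (1 + (n + k)) := by ring
  set J : Fin g → ℂ := fun a ↦ torusIntegral Φ0 (Equiv.refl _) ((T a).domDomCongr (finCongr h2)) with hJ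
  have hJsum : ∑ a, (c a : ℂ) * J a = 0 := by
    have h := congrArg (fun X : E [⋀^Fin (2 * (n + 1) + (k + k))]→L[ℝ] ℂ ↦
      torusIntegral Φ0 (Equiv.refl _) (X.domDomCongr (finCongr h2))) hsum
    beta_reduce at h
    rw [torusIntegral_domDomCongr_sum_smul] at h
    rw [h]
    simp only [torusIntegral, ContinuousAlternatingMap.domDomCongr_apply, ContinuousAlternatingMap.coe_zero,
      Pi.zero_apply, mul_zero]
  -- (3) for each `a`: `σ J_a ≥ 0`, and `σ J_a = 0 ⇒ A|_{ker w_a^*} = 0`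
  have hstep : ∀ a, 0 ≤ σ * J a ∧ (σ * J a = 0 →
      A.compContinuousLinearMap ((LinearMap.ker (basisCoordCLM w a).toLinearMap).subtypeL.restrictScalars ℝ) = 0) := by
    intro a
    set S : Submodule ℂ E := LinearMap.ker (basisCoordCLM w a).toLinearMap with hSdef
    have hS : ∀ x : S, basisCoordCLM w a x = 0 := fun x ↦ x.2
    have hSm : finrank ℂ S = n + k := by
      have h := finrank_ker_basisCoordCLM_add_one w a
      rw [← hSdef] at h
      omega
    set u : Module.Basis (Fin (n + k)) ℂ S := Module.finBasisOfFinrankEq ℂ S hSm with hu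
    have hv : basisCoordCLM w a (w a) ≠ 0 := by rw [basisCoordCLM_apply_self]; exact one_ne_zero
    have hli := linearIndependent_append_single_of_apply_ne_zero (basisCoordCLM w a) S hS u hv
    set uE : Module.Basis (Fin (1 + (n + k))) ℂ E :=
      basisOfLinearIndependentOfCardEqFinrank hli (by rw [Fintype.card_fin, hm]) with huE
    have huE' : ⇑uE = Fin.append ![w a] (fun j ↦ (u j : E)) := by
      rw [huE, coe_basisOfLinearIndependentOfCardEqFinrank]
    obtain ⟨ρ, hρ, hvol⟩ := exists_volumeForm_apply_interleave_eq Φ0 (Equiv.refl _) uE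
    have hEval := apply_interleave_eq_torusIntegral_mul Φ0 (Equiv.refl _) uE ((T a).domDomCongr (finCongr h2))
    rw [hvol, ContinuousAlternatingMap.domDomCongr_apply, huE'] at hEval
    have hcast : ((fun i ↦ Sum.elim (Fin.append ![w a] (fun j ↦ (u j : E)))
        (fun j ↦ I • Fin.append ![w a] (fun j ↦ (u j : E)) j) (finTwoMulEquivSum (1 + (n + k)) i)) ∘
          ⇑(finCongr h2)) =
        ((fun i ↦ Sum.elim (Fin.append ![w a] (fun j ↦ (u j : E)))
          (fun j ↦ I • Fin.append ![w a] (fun j ↦ (u j : E)) j) (finTwoMulEquivSum (1 + (n + k)) i)) ∘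
            Fin.cast h2) := rfl
    have hkey := wedgeFamily_snoc_principalTwoForm_wedge_apply_interleave_append (basisCoordCLM w a) S hS Θ' B
      (w a) u hc h2
    rw [hcast] at hEval
    replace hEval : ((wedgeFamily (n + 1) (Fin.snoc Θ' (principalTwoForm (basisCoordCLM w a)))).wedge B)
        ((fun i ↦ Sum.elim (Fin.append ![w a] (fun j ↦ (u j : E)))
          (fun j ↦ I • Fin.append ![w a] (fun j ↦ (u j : E)) j) (finTwoMulEquivSum (1 + (n + k)) i)) ∘
            Fin.cast h2) = J a * ρ := hEval
    rw [hkey, basisCoordCLM_apply_self, map_one, Complex.ofReal_one, one_mul] at hEval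
    -- the restricted data
    set ιS : S →L[ℝ] E := S.subtypeL.restrictScalars ℝ with hιS
    set A' : S [⋀^Fin k]→L[ℝ] ℂ := A.compContinuousLinearMap ιS with hA'def
    have hΘ'S : (fun j ↦ (Θ' j).compContinuousLinearMap ιS) =
        fun j ↦ ofRealForm (-((θ (Fin.castSucc j)).compContinuousLinearMap ιS)) := by
      funext j; ext v; rfl
    have hB' : B.compContinuousLinearMap ιS = A'.wedge (conjForm A') := wedge_conjForm_compContinuousLinearMap A ιS
    rw [hΘ'S, hB'] at hEval
    -- `hEval : X = J a * ρ` with `X` the Hodge–Riemann quantity of `A'` on `S`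
    have hA'mem : A' ∈ typeSubmodule S k p q := compContinuousLinearMap_mem_typeSubmodule hpq hA S.subtypeL
    have hprim : (wedgeFamily (n + 1) fun j ↦ ofRealForm (-((θ j).compContinuousLinearMap ιS))).wedge A' = 0 := by
      have h := wedgeFamily_wedge_compContinuousLinearMap_eq_zero h0 ιS
      have hfam : (fun j ↦ (ofRealForm (-(θ j))).compContinuousLinearMap ιS) =
          fun j ↦ ofRealForm (-((θ j).compContinuousLinearMap ιS)) := by
        funext j; ext v; rfl
      rw [hfam] at h
      exact h
    have hX_nonneg : 0 ≤ σ * (J a * ρ) := by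
      by_cases hA'0 : A' = 0
      · rw [← hEval, hA'0, conj_zero, ContinuousAlternatingMap.wedge_zero, ContinuousAlternatingMap.wedge_zero,
          ContinuousAlternatingMap.coe_zero, Pi.zero_apply, mul_zero]
      · rw [← hEval]; exact (hHR S u A' hA'mem hprim hA'0).le
    have hρ' : (ρ : ℂ) ≠ 0 := by exact_mod_cast hρ.ne'
    refine ⟨?_, fun hzero ↦ ?_⟩
    · have : σ * J a = σ * (J a * ρ) * ((ρ⁻¹ : ℝ) : ℂ) := by
        rw [Complex.ofReal_inv]; field_simp
      rw [this]
      exact mul_nonneg hX_nonneg (Complex.zero_le_real.2 (inv_nonneg.2 hρ.le))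
    · by_contra hA'0
      have hlt := hHR S u A' hA'mem hprim hA'0
      rw [hEval, ← mul_assoc, hzero, zero_mul] at hlt
      exact lt_irrefl _ hlt
  -- (4) all the terms vanish
  have hterms : ∀ a, σ * J a = 0 := by
    have hsum0 : ∑ a, (c a : ℂ) * (σ * J a) = 0 := by
      rw [show ∑ a, (c a : ℂ) * (σ * J a) = σ * ∑ a, (c a : ℂ) * J a by
        rw [Finset.mul_sum]; exact Finset.sum_congr rfl fun a _ ↦ by ring, hJsum, mul_zero]
    have hnn : ∀ a ∈ (Finset.univ : Finset (Fin g)), 0 ≤ (c a : ℂ) * (σ * J a) := fun a _ ↦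
      mul_nonneg (Complex.zero_le_real.2 (hc_pos a).le) (hstep a).1
    intro a
    have h := (Finset.sum_eq_zero_iff_of_nonneg hnn).1 hsum0 a (Finset.mem_univ a)
    rcases mul_eq_zero.1 h with h | h
    · exact absurd (by exact_mod_cast h : c a = 0) (hc_pos a).ne'
    · exact h
  -- (5) `A` vanishes on all the coordinate hyperplanes, hence `A = 0` (`k < g`)
  exact eq_zero_of_forall_compContinuousLinearMap_ker_coord_eq_zero w (by omega) A fun a ↦ (hstep a).2 (hterms a)

end HyperplaneStep

end ComplexTorus

end Literature.Geometry.Kaehler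

end
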